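import Literature.NumberTheory.Weil1965.LocalQuadraticFibreDensity
import HarnessLib

/-!
# The fibre density of a diagonal quadratic form: compact support, total mass, Fourier duality, positivity
(Weil 1965, Chap. III n° 34–36, Prop. 6 — finite places; companion of `LocalQuadraticFibreDensity.lean`)

Topic `NumberTheory/Weil1965`; namespace `Literature.NumberTheory.Weil1965`.  KERNEL mathematics only (theorems; no
definition, no named fact, no `axiom`, no proof hole).

Notation as in `LocalQuadraticFibreDensity.lean`: `F` a `p`-field, `μ` Haar, `ψ` of conductor exponent `d`, `‖2‖ = q^{-v₂}`,
`f = Σ cᵢ xᵢ²` diagonal non-degenerate on `F^ι` with `r = card ι ≥ 3`, `Φ ∈ 𝒮(F^ι)`, `G_Φ(β) = ∫ Φ(x) ψ(β f(x)) dμ^⊗ι`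
(written `∫ x, Φ x * psiSqPi ψ (β • c) x ∂μ^⊗ι`) and the density `F_Φ(b) := 𝓕G_Φ(-b)` (up to the constant `q^{-d} μ(𝒪)²`).
Weil's Proposition 6 says that `F_Φ` and `F*_Φ = G_Φ` are continuous, INTEGRABLE and FOURIER TRANSFORMS OF EACH OTHER;
at a finite place more is true because `Φ` has compact support:

* §1 COMPACT SUPPORT: `f` is bounded on the support box of `Φ`, so `𝓕G_Φ(-b) = 0` off a ball `𝔭^M`
  (`fourierSB_integral_mul_psiSqPi_neg_eq_zero_of_notMem`, from the limit-of-averages formula), and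
  `b ↦ 𝓕G_Φ(-b)` is INTEGRABLE (`integrable_fourierSB_integral_mul_psiSqPi_neg`);
* §2 TOTAL MASS `∫_F 𝓕G_Φ(-b) db = (q^{-d} μ(𝒪)²) ∫ Φ` (`integral_fourierSB_integral_mul_psiSqPi_neg`) and FOURIER DUALITY
  `𝓕(b ↦ 𝓕G_Φ(-b))(β) = (q^{-d} μ(𝒪)²) · G_Φ(β)` (`fourierSB_fourierSB_integral_mul_psiSqPi_neg`) — the disintegration
  identity tested against `ψ(·β) 1_{𝔭^M} ∈ 𝒮(F)`;
* §3 POSITIVITY: for `Φ = φ ≥ 0` real, `𝓕G_Φ(-b)` is a non-negative real for every `b`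
  (`fourierSB_integral_mul_psiSqPi_neg_mem_of_nonneg`, closedness under the limit of averages).

## References

* [Weil1965] A. Weil, *Sur la formule de Siegel dans la théorie des groupes classiques*, Acta Math. 113 (1965) 1–87:
  Chap. I n° 1–2 (pp. 4–8), Chap. III n° 36 Prop. 6 (p. 54).
* [Tate1950] J. Tate, *Fourier analysis in number fields and Hecke's zeta-functions* (1950), §2.2.
-/

set_option autoImplicit false

noncomputable section

open MeasureTheory ValuativeRel Filter Topology Set
open scoped NNReal ENNReal Pointwise
open Literature.NumberTheory.GaloisRepresentations.IsNonarchimedeanLocalField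
open Literature.NumberTheory.Automorphic
open Literature.NumberTheory.Weil1964

namespace Literature.NumberTheory.Weil1965

variable {F : Type*} [Field F] [ValuativeRel F] [TopologicalSpace F] [IsNonarchimedeanLocalField F]

section Mass

variable {ι : Type*} [Fintype ι] [MeasurableSpace F] [BorelSpace F] (μ : Measure F) [μ.IsAddHaarMeasure]
  {ψ : AddChar F Circle}

omit [MeasurableSpace F] [BorelSpace F] in
/-- **the form is bounded on the support of `Φ`**: there is `M` with `Φ x ≠ 0 ⟹ f(x) ∈ 𝔭^M`.
[cite: Weil1965, Chap. I n° 2, p. 8] -/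
theorem exists_sum_sq_mem_primePowBall_of_ne_zero (c : ι → F) {Φ : (ι → F) → ℂ}
    (hΦ : Φ ∈ SchwartzBruhat (ι → F)) :
    ∃ M : ℤ, ∀ x, Φ x ≠ 0 → ∑ i, c i * x i ^ 2 ∈ primePowBall F M := by
  classical
  obtain ⟨n₀, hn₀⟩ := exists_eq_zero_of_notMem_piPrimePowBall hΦ
  have hci : ∀ i, ∃ k : ℤ, c i ∈ primePowBall F k := fun i => exists_mem_primePowBall (c i)
  choose k hk using hci
  -- a common exponent below all `k i`: the sum of the non-positive parts
  set k₀ : ℤ := ∑ j, min (k j) 0 with hk₀def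
  have hk₀ : ∀ i, k₀ ≤ k i := by
    intro i
    have h1 : k₀ = min (k i) 0 + ∑ j ∈ Finset.univ.erase i, min (k j) 0 :=
      (Finset.add_sum_erase Finset.univ (fun j => min (k j) 0) (Finset.mem_univ i)).symm
    have h2 : ∑ j ∈ Finset.univ.erase i, min (k j) 0 ≤ 0 := Finset.sum_nonpos fun j _ => min_le_right _ _
    have h3 : min (k i) 0 ≤ k i := min_le_left _ _
    omega
  refine ⟨k₀ + n₀ + n₀, fun x hx => ?_⟩
  have hxbox : x ∈ piPrimePowBall F ι n₀ := by
    by_contra h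
    exact hx (hn₀ x h)
  refine sum_mem_primePowBall Finset.univ fun i _ => ?_
  have hxi : x i ∈ primePowBall F n₀ := (mem_piPrimePowBall_iff.1 hxbox) i
  have h3 := mul_mem_primePowBall (mul_mem_primePowBall (primePowBall_antitone (hk₀ i) (hk i)) hxi) hxi
  rwa [show c i * x i * x i = c i * x i ^ 2 by ring] at h3

omit [MeasurableSpace F] [BorelSpace F] in
/-- `(b₀ + 𝔭^k) ∩ 𝔭^M = ∅` when `b₀ ∉ 𝔭^M` and `M ≤ k`. [folklore] -/
private theorem not_mem_vadd_of_notMem {b₀ t : F} {M k : ℤ} (hb₀ : b₀ ∉ primePowBall F M) (hk : M ≤ k)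
    (ht : t ∈ primePowBall F M) : t ∉ b₀ +ᵥ primePowBall F k := by
  intro h
  rw [mem_vadd_primePowBall_iff] at h
  apply hb₀
  have : b₀ = t + -(t - b₀) := by ring
  rw [this]
  exact add_mem_primePowBall ht (neg_mem_primePowBall (primePowBall_antitone hk h))

/-- **COMPACT SUPPORT OF THE FIBRE DENSITY**: with `M` as in `exists_sum_sq_mem_primePowBall_of_ne_zero` (`f ∈ 𝔭^M` on the
support of `Φ`), `𝓕G_Φ(-b) = 0` for every `b ∉ 𝔭^M` — the averages `μ(𝔭^k)⁻¹ ∫ Φ 1_{b+𝔭^k}(f)` vanish identically for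
`k ≥ M`. [cite: Weil1965, Chap. III n° 36 Prop. 6, p. 54] -/
theorem fourierSB_integral_mul_psiSqPi_neg_eq_zero_of_notMem {d : ℤ} (hd : ψ.HasConductorExp d) {v₂ : ℤ}
    (h2 : normAbs F (2 : F) = (residueFieldCard F : ℝ≥0)⁻¹ ^ v₂) {c : ι → F} (hc : ∀ i, c i ≠ 0)
    {Φ : (ι → F) → ℂ} (hΦ : Φ ∈ SchwartzBruhat (ι → F)) (hr : 3 ≤ Fintype.card ι) {M : ℤ}
    (hM : ∀ x, Φ x ≠ 0 → ∑ i, c i * x i ^ 2 ∈ primePowBall F M) {b : F} (hb : b ∉ primePowBall F M) :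
    fourierSB ψ μ (fun β => ∫ x, Φ x * psiSqPi ψ (fun i => β * c i) x ∂(Measure.pi fun _ : ι => μ)) (-b) = 0 := by
  haveI : T2Space F :=
    (Literature.NumberTheory.GaloisRepresentations.IsNonarchimedeanLocalField.isLocalField F).toT2Space
  have h := tendsto_average_fibre μ hd h2 hc hΦ hr b
  -- the averages are eventually `0`
  have h0 : ∀ᶠ k : ℕ in atTop, (selfDualConst μ d : ℂ) * (μ.real (primePowBall F k) : ℂ)⁻¹ *
      ∫ x, Φ x * (b +ᵥ primePowBall F k).indicator (fun _ => (1 : ℂ)) (∑ i, c i * x i ^ 2)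
        ∂(Measure.pi fun _ : ι => μ) = 0 := by
    filter_upwards [eventually_ge_atTop M.toNat] with k hk
    have hk' : M ≤ (k : ℤ) := by omega
    have hzero : (fun x => Φ x * (b +ᵥ primePowBall F k).indicator (fun _ => (1 : ℂ)) (∑ i, c i * x i ^ 2)) = 0 := by
      funext x
      by_cases hx : Φ x = 0
      · rw [hx, zero_mul, Pi.zero_apply]
      · rw [Set.indicator_of_notMem (not_mem_vadd_of_notMem hb hk' (hM x hx)), mul_zero, Pi.zero_apply]
    rw [hzero, integral_zero', mul_zero]
  exact tendsto_nhds_unique h (tendsto_const_nhds.congr' (h0.mono fun k hk => hk.symm))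

/-- **THE FIBRE DENSITY IS INTEGRABLE** (continuous with support in the compact ball `𝔭^M`) — Weil's "`F_Φ` … intégrable".
[cite: Weil1965, Chap. III n° 36 Prop. 6, p. 54] -/
theorem integrable_fourierSB_integral_mul_psiSqPi_neg {d : ℤ} (hd : ψ.HasConductorExp d) {v₂ : ℤ}
    (h2 : normAbs F (2 : F) = (residueFieldCard F : ℝ≥0)⁻¹ ^ v₂) {c : ι → F} (hc : ∀ i, c i ≠ 0)
    {Φ : (ι → F) → ℂ} (hΦ : Φ ∈ SchwartzBruhat (ι → F)) (hr : 3 ≤ Fintype.card ι) :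
    Integrable (fun b => fourierSB ψ μ
      (fun β => ∫ x, Φ x * psiSqPi ψ (fun i => β * c i) x ∂(Measure.pi fun _ : ι => μ)) (-b)) μ := by
  obtain ⟨M, hM⟩ := exists_sum_sq_mem_primePowBall_of_ne_zero c hΦ
  refine (continuous_fourierSB_integral_mul_psiSqPi_neg μ hd h2 hc hΦ hr).integrable_of_hasCompactSupport
    (HasCompactSupport.intro' (isCompact_primePowBall M) (isClosed_primePowBall M) fun b hb => ?_)
  exact fourierSB_integral_mul_psiSqPi_neg_eq_zero_of_notMem μ hd h2 hc hΦ hr hM hb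

omit [MeasurableSpace F] [BorelSpace F] in
/-- a character with a conductor exponent is locally constant, hence so is `b ↦ ψ(b β)`; times the indicator of a ball
it is a Schwartz–Bruhat function. [cite: Tate1950, §2.2] -/
theorem addChar_mul_indicator_primePowBall_mem_schwartzBruhat {d : ℤ} (hd : ψ.HasConductorExp d) (β : F) (M : ℤ) :
    (fun b => ((ψ (b * β) : Circle) : ℂ) * (primePowBall F M).indicator (fun _ => (1 : ℂ)) b) ∈ SchwartzBruhat F := by
  have hψlc : IsLocallyConstant (fun b : F => ((ψ (b * β) : Circle) : ℂ)) := by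
    refine (IsLocallyConstant.iff_eventually_eq _).2 fun b => ?_
    have hU : b +ᵥ primePowBall F (d - 0 - 0) ∈ 𝓝 b :=
      (isOpen_vadd_primePowBall _ b).mem_nhds (self_mem_vadd_primePowBall _ b)
    obtain ⟨k, hk⟩ := exists_mem_primePowBall β
    have hU' : b +ᵥ primePowBall F (d - k) ∈ 𝓝 b :=
      (isOpen_vadd_primePowBall _ b).mem_nhds (self_mem_vadd_primePowBall _ b)
    filter_upwards [hU'] with y hy
    rw [mem_vadd_primePowBall_iff] at hy
    have hmem : (y - b) * β ∈ primePowBall F d := by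
      have := mul_mem_primePowBall hy hk
      rwa [sub_add_cancel] at this
    calc ((ψ (y * β) : Circle) : ℂ) = ((ψ (b * β + (y - b) * β) : Circle) : ℂ) := by ring_nf
      _ = ((ψ (b * β) : Circle) : ℂ) := by rw [AddChar.map_add_eq_mul, hd.1 _ hmem, mul_one]
  have hind : (primePowBall F M).indicator (fun _ => (1 : ℂ)) ∈ SchwartzBruhat F := indicator_primePowBall_mem_schwartzBruhat M 1
  rw [mem_schwartzBruhat_iff] at hind ⊢
  refine ⟨hψlc.mul hind.1, ?_⟩
  exact hind.2.mul_left

/-- **TOTAL MASS**: `∫_F 𝓕G_Φ(-b) dμ(b) = (q^{-d} μ(𝒪)²) · ∫ Φ dμ^⊗ι` — the image measure `f_*(Φ dx)` has total mass `∫ Φ`.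
[cite: Weil1965, Chap. III n° 36 Prop. 6, p. 54] -/
theorem integral_fourierSB_integral_mul_psiSqPi_neg {d : ℤ} (hd : ψ.HasConductorExp d) {v₂ : ℤ}
    (h2 : normAbs F (2 : F) = (residueFieldCard F : ℝ≥0)⁻¹ ^ v₂) {c : ι → F} (hc : ∀ i, c i ≠ 0)
    {Φ : (ι → F) → ℂ} (hΦ : Φ ∈ SchwartzBruhat (ι → F)) (hr : 3 ≤ Fintype.card ι) :
    ∫ b, fourierSB ψ μ (fun β => ∫ x, Φ x * psiSqPi ψ (fun i => β * c i) x ∂(Measure.pi fun _ : ι => μ)) (-b) ∂μ =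
      (selfDualConst μ d : ℂ) * ∫ x, Φ x ∂(Measure.pi fun _ : ι => μ) := by
  obtain ⟨M, hM⟩ := exists_sum_sq_mem_primePowBall_of_ne_zero c hΦ
  have h := integral_fourierSB_integral_mul_psiSqPi_neg_mul μ hd h2 hc hΦ hr
    (indicator_primePowBall_mem_schwartzBruhat M (1 : ℂ))
  -- left: the indicator is `1` wherever the density is non-zero; right: `1` on the support of `Φ`
  have hL : (fun b => fourierSB ψ μ (fun β => ∫ x, Φ x * psiSqPi ψ (fun i => β * c i) x ∂(Measure.pi fun _ : ι => μ)) (-b) *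
      (primePowBall F M).indicator (fun _ => (1 : ℂ)) b) =
      fun b => fourierSB ψ μ (fun β => ∫ x, Φ x * psiSqPi ψ (fun i => β * c i) x ∂(Measure.pi fun _ : ι => μ)) (-b) := by
    funext b
    by_cases hb : b ∈ primePowBall F M
    · rw [Set.indicator_of_mem hb, mul_one]
    · rw [fourierSB_integral_mul_psiSqPi_neg_eq_zero_of_notMem μ hd h2 hc hΦ hr hM hb, zero_mul]
  have hR : (fun x => Φ x * (primePowBall F M).indicator (fun _ => (1 : ℂ)) (∑ i, c i * x i ^ 2)) = Φ := by
    funext x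
    by_cases hx : Φ x = 0
    · rw [hx, zero_mul]
    · rw [Set.indicator_of_mem (hM x hx), mul_one]
  rw [hL, hR] at h
  exact h

/-- **FOURIER DUALITY** [Weil1965, Prop. 6: `F_Φ` and `F*_Φ` are Fourier transforms of each other]: for every `β ∈ F`,
`∫_F ψ(b β) 𝓕G_Φ(-b) dμ(b) = (q^{-d} μ(𝒪)²) · G_Φ(β)` — the disintegration identity tested against the Schwartz–Bruhat
function `ψ(·β) 1_{𝔭^M}`. [cite: Weil1965, Chap. III n° 36 Prop. 6, p. 54] -/
theorem fourierSB_fourierSB_integral_mul_psiSqPi_neg {d : ℤ} (hd : ψ.HasConductorExp d) {v₂ : ℤ}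
    (h2 : normAbs F (2 : F) = (residueFieldCard F : ℝ≥0)⁻¹ ^ v₂) {c : ι → F} (hc : ∀ i, c i ≠ 0)
    {Φ : (ι → F) → ℂ} (hΦ : Φ ∈ SchwartzBruhat (ι → F)) (hr : 3 ≤ Fintype.card ι) (β : F) :
    fourierSB ψ μ (fun b => fourierSB ψ μ
        (fun β' => ∫ x, Φ x * psiSqPi ψ (fun i => β' * c i) x ∂(Measure.pi fun _ : ι => μ)) (-b)) β =
      (selfDualConst μ d : ℂ) * ∫ x, Φ x * psiSqPi ψ (fun i => β * c i) x ∂(Measure.pi fun _ : ι => μ) := by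
  obtain ⟨M, hM⟩ := exists_sum_sq_mem_primePowBall_of_ne_zero c hΦ
  have h := integral_fourierSB_integral_mul_psiSqPi_neg_mul μ hd h2 hc hΦ hr
    (addChar_mul_indicator_primePowBall_mem_schwartzBruhat hd β M)
  have hL : (fun b => fourierSB ψ μ (fun β' => ∫ x, Φ x * psiSqPi ψ (fun i => β' * c i) x ∂(Measure.pi fun _ : ι => μ)) (-b) *
      (((ψ (b * β) : Circle) : ℂ) * (primePowBall F M).indicator (fun _ => (1 : ℂ)) b)) =
      fun b => ((ψ (b * β) : Circle) : ℂ) *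
        fourierSB ψ μ (fun β' => ∫ x, Φ x * psiSqPi ψ (fun i => β' * c i) x ∂(Measure.pi fun _ : ι => μ)) (-b) := by
    funext b
    by_cases hb : b ∈ primePowBall F M
    · rw [Set.indicator_of_mem hb, mul_one, mul_comm]
    · rw [fourierSB_integral_mul_psiSqPi_neg_eq_zero_of_notMem μ hd h2 hc hΦ hr hM hb, zero_mul, mul_zero]
  have hR : (fun x => Φ x * (((ψ ((∑ i, c i * x i ^ 2) * β) : Circle) : ℂ) *
      (primePowBall F M).indicator (fun _ => (1 : ℂ)) (∑ i, c i * x i ^ 2))) =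
      fun x => Φ x * psiSqPi ψ (fun i => β * c i) x := by
    funext x
    by_cases hx : Φ x = 0
    · rw [hx, zero_mul, zero_mul]
    · rw [Set.indicator_of_mem (hM x hx), mul_one, psiSqPi_smul_apply, mul_comm _ β]
  rw [hL, hR] at h
  rw [fourierSB_apply]
  exact h

/-- **POSITIVITY**: for a non-negative real `Φ = φ ≥ 0`, `𝓕G_Φ(-b)` is a NON-NEGATIVE REAL NUMBER for every `b ∈ F` (the
averages `(q^{-d}μ(𝒪)²) μ(𝔭^k)⁻¹ ∫ φ 1_{b+𝔭^k}(f)` are, and the non-negative reals are closed in `ℂ`) — Weil's `μ_b`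
are POSITIVE measures. [cite: Weil1965, Chap. I n° 2, p. 8] -/
theorem fourierSB_integral_mul_psiSqPi_neg_mem_of_nonneg {d : ℤ} (hd : ψ.HasConductorExp d) {v₂ : ℤ}
    (h2 : normAbs F (2 : F) = (residueFieldCard F : ℝ≥0)⁻¹ ^ v₂) {c : ι → F} (hc : ∀ i, c i ≠ 0)
    {φ : (ι → F) → ℝ} (hφ : ∀ x, 0 ≤ φ x) (hΦ : (fun x => ((φ x : ℝ) : ℂ)) ∈ SchwartzBruhat (ι → F))
    (hr : 3 ≤ Fintype.card ι) (b : F) :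
    fourierSB ψ μ (fun β => ∫ x, ((φ x : ℝ) : ℂ) * psiSqPi ψ (fun i => β * c i) x ∂(Measure.pi fun _ : ι => μ)) (-b) ∈
      ((fun r : ℝ => (r : ℂ)) '' Set.Ici 0) := by
  have hclosed : IsClosed ((fun r : ℝ => (r : ℂ)) '' Set.Ici (0 : ℝ)) := by
    have e : ((fun r : ℝ => (r : ℂ)) '' Set.Ici (0 : ℝ)) = {z : ℂ | 0 ≤ z.re ∧ z.im = 0} := by
      ext z
      constructor
      · rintro ⟨r, hr, rfl⟩
        exact ⟨by simpa using hr, Complex.ofReal_im r⟩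
      · rintro ⟨h1, h2⟩
        exact ⟨z.re, h1, Complex.ext (by simp) (by simp [h2])⟩
    rw [e]
    exact (isClosed_le continuous_const Complex.continuous_re).inter (isClosed_eq Complex.continuous_im continuous_const)
  refine hclosed.mem_of_tendsto (tendsto_average_fibre μ hd h2 hc hΦ hr b) (Eventually.of_forall fun k => ?_)
  -- each average is a non-negative real
  have hint : ∫ x, ((φ x : ℝ) : ℂ) * (b +ᵥ primePowBall F k).indicator (fun _ => (1 : ℂ)) (∑ i, c i * x i ^ 2)
      ∂(Measure.pi fun _ : ι => μ) =
      ((∫ x, φ x * (b +ᵥ primePowBall F k).indicator (fun _ => (1 : ℝ)) (∑ i, c i * x i ^ 2)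
        ∂(Measure.pi fun _ : ι => μ) : ℝ) : ℂ) := by
    have e : (fun x => ((φ x : ℝ) : ℂ) * (b +ᵥ primePowBall F k).indicator (fun _ => (1 : ℂ)) (∑ i, c i * x i ^ 2)) =
        fun x => ((φ x * (b +ᵥ primePowBall F k).indicator (fun _ => (1 : ℝ)) (∑ i, c i * x i ^ 2) : ℝ) : ℂ) := by
      funext x
      by_cases hx : (∑ i, c i * x i ^ 2) ∈ b +ᵥ primePowBall F k
      · rw [Set.indicator_of_mem hx, Set.indicator_of_mem hx, mul_one, mul_one]
      · rw [Set.indicator_of_notMem hx, Set.indicator_of_notMem hx, mul_zero, mul_zero, Complex.ofReal_zero]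
    rw [e]
    exact integral_ofReal
  refine ⟨selfDualConst μ d * (μ.real (primePowBall F k))⁻¹ *
    ∫ x, φ x * (b +ᵥ primePowBall F k).indicator (fun _ => (1 : ℝ)) (∑ i, c i * x i ^ 2) ∂(Measure.pi fun _ : ι => μ),
    ?_, ?_⟩
  · refine mul_nonneg (mul_nonneg (selfDualConst_pos μ).le (inv_nonneg.2 measureReal_nonneg))
      (integral_nonneg fun x => mul_nonneg (hφ x) ?_)
    by_cases hx : (∑ i, c i * x i ^ 2) ∈ b +ᵥ primePowBall F k
    · rw [Set.indicator_of_mem hx]; exact zero_le_one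
    · rw [Set.indicator_of_notMem hx]
  · rw [hint]
    push_cast
    ring

end Mass

end Literature.NumberTheory.Weil1965
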